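import Summits.CriticalPhenomena.CardyFormulaZ2.Theorems.CardyComplexConeEdgePrecompactUFRSArmDomination

set_option linter.unusedVariables false

/-!
# Arm domination, INITIAL case with a contact: the junction strands when the bigon of the two start strands is large
(line `qkz-strip-boundary-arm` of crux `CardyComplexCone.EdgePrecompact`, stmt-CriticalPhenomena-11387;
analysis of the registered residual `ufrs_initialContactCase_cert(J)` of the corrected arm domination
`ufrs_armDomination2`, see `…UFRSArmDominationInitial.lean` and `…UFRSArmDominationResiduals.lean`)

The residual INITIAL configuration "contact": the first stretch `S₀ = O₀ a [0, n]` of the exploration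
of `E` from its start corner `a` (marked edge `e_a = cSrc a`) to the `2ρ`-deep ball `B(E.δ v, ρ)` and
the run `R₁ = O₁ a' [0, T]` of the translate `shiftData E w` from its start corner `a' = a + w` MEET,
first (in the time of `R₁`) at `O₁ a' j = O₀ a i`, with a nonzero turning offset `2πℓ`. Write
`P₀' = O₀ a [0, i)` and `P₁' = O₁ a' [0, j)` for the two prefixes before the contact corner
`c = O₀ a i` (the BIGON of the contact: two corner-disjoint simple medial paths from the translates
`a`, `a'` merging head-on into `c`) and `z = E.δ a.1` for the start vertex (a collar point, with the
marked edge `e_a` within `E.δ`).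

`ufrs_initialContact_farBigon_IC`: if the bigon is LARGE — a corner of `P₁'` at distance `≥ ρ/4`
from `z`, or a corner of `P₀'` at distance `≥ ρ/4 + E.δ` — then at `z` either the certificate
`ufrsCert E w z (4η) (ρ/2)` holds or the JUNCTION data of the J-form of the residual hold (marked
edge within `4η`, a dyadic `R' ≥ 128 η`, two strand-crossings of `A(z; 4η, R')` and two of
`A(z; 4R', ρ/4)`). The named strands: if `P₁'` reaches `ρ/4`, `S₀` and that prefix of `P₁'` are
two long corner-disjoint strands from the `η`-ball of `z` (NEAR); otherwise `P₁'` has extent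
`u < ρ/4`, so the contact corner `c` (successor of the last corner of `P₁'`) is within `u + E.δ`
of `z`, while `P₀'` reaches `ρ/4 + E.δ` at `t₀ < i`: the two pieces `O₀ a [0, t₀]`,
`O₀ a [t₀ + 1, i]` of the simple stretch `S₀` cross from the `(u + E.δ)`-ball of `z` to distance
`ρ/4` (NEAR if `u + E.δ ≤ 512 η`; else the junction data with the dyadic `R' ∈ (u/2, u]`, the small
annulus `A(z; 4η, R')` being crossed by `S₀` and by `P₁'` up to its farthest corner). No use is
made of the turning offset: this is the topology-free part of the residual. What remains of
`ufrs_initialContactCase_certJ` is the SMALL bigon (both prefixes within `ρ/4 (+E.δ)` of `z`),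
a planar statement about the turning of a small cusp-free bigon at the marked point.

References: S. Smirnov, C. R. Acad. Sci. Paris 333 (2001), §2 (the exploration process);
P. Nolin, Electron. J. Probab. 13 (2008), §4 (arm events near the boundary).
-/

namespace Summit.CriticalPhenomena.CardyFormulaZ2.Cruxes.EdgePrecompact.QkzStripBoundaryArm

open MeasureTheory Filter Set Metric
open scoped Topology BigOperators Pointwise
open Literature.Probability.LatticeModels Literature.Probability.Percolation
open Literature.Probability.RandomPlanarGeometry (DobrushinDomain)
open Summit.CriticalPhenomena.CardyFormulaZ2.Theses.CardyComplexCone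

noncomputable section

/-- **INITIAL case with a contact, LARGE bigon: certificate or junction data at the start vertex.**
DATA: the hypotheses of the residual `ufrs_initialContactCase_certJ` (INITIAL branch of
`ufrs_failureStructure`, the run `R₁ = O₁ a' [0, T]` of the translate meeting the first stretch
`S₀ = O₀ a [0, n]` first at `O₁ a' j = O₀ a i`, turning offset `2πℓ ≠ 0`) and the largeness of the
bigon: a corner `O₁ a' t`, `t < j`, at distance `≥ ρ/4` from `z = E.δ a.1`, or a corner `O₀ a t`,
`t < i`, at distance `≥ ρ/4 + E.δ`. CONCLUSION: the conclusion of the J-form at `z`: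
`ω ∈ ufrsCert E w z (4η) (ρ/2)` (escape or NEAR) or the junction data (marked edge within `4η`,
dyadic `R' = ρ/4/2^(k+1) ≥ 32·4η`, two strands across `A(z; 4η, R')`, two across `A(z; 4R', ρ/4)`). -/
theorem ufrs_initialContact_farBigon_IC : ∀ (D : DobrushinDomain) (η : ℝ), 0 < η → ∃ δ₀ > (0:ℝ), ∀ E : DiscreteDobrushin, E.Ω = D.carrier → E.IsZdAdmissible → E.δ < δ₀ → ∀ (v w : Site 2) (ρ : ℝ), 4 * η ≤ ρ → 2 * ρ ≤ infDist (meshPoint E.δ v) D.carrierᶜ → ‖meshPoint E.δ w‖ < η → ∀ (ω : BondConfig (Site 2)) (a a' : Site 2 × Fin 4) (n T j i : ℕ) (ℓ : ℤ), E.IsStartCorner a → (shiftData E w).IsStartCorner a' → (∀ i < n, medialPoint E.δ (cTgt (cornerOrbit (E.bcBondConfig ω) a i)) ∉ ball (meshPoint E.δ v) ρ ∧ E.IsInnerFace (cFace (cornerOrbit (E.bcBondConfig ω) a (i + 1)))) → medialPoint E.δ (cTgt (cornerOrbit (E.bcBondConfig ω) a n)) ∈ ball (meshPoint E.δ v) ρ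 → (∀ m k : ℕ, m ≤ n → (∀ i < k, medialPoint E.δ (cTgt (cornerOrbit ((shiftData E w).bcBondConfig ω) a' i)) ∉ ball (meshPoint E.δ v) ρ ∧ (shiftData E w).IsInnerFace (cFace (cornerOrbit ((shiftData E w).bcBondConfig ω) a' (i + 1)))) → cornerOrbit ((shiftData E w).bcBondConfig ω) a' k = cornerOrbit (E.bcBondConfig ω) a m → ∑ i ∈ Finset.range k, turnOf ((shiftData E w).bcBondConfig ω) (cornerOrbit ((shiftData E w).bcBondConfig ω) a' i) ≠ ∑ i ∈ Finset.range m, turnOf (E.bcBondConfig ω) (cornerOrbit (E.bcBondConfig ω) a i)) → (∀ i < T, medialPoint E.δ (cTgt (cornerOrbit ((shiftData E w).bcBondConfig ω) a' i)) ∉ ball (meshPoint E.δ v) ρ ∧ (shiftData E w).IsInnerFace (cFace (cornerOrbit ((shiftData E w).bcBondConfig ω) a' (i + 1)))) → (medialPoint E.δ (cTgt (cornerOrbit ((shiftData E w).bcBondConfig ω) a' T)) ∈ ball (meshPoint E.δ v) ρ ∨ ¬ (shiftData E w).IsInnerFace (cFace (cornerOrbit ((shiftData E w).bcBondConfig ω)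 a' (T + 1)))) → j ≤ T → i ≤ n → cornerOrbit ((shiftData E w).bcBondConfig ω) a' j = cornerOrbit (E.bcBondConfig ω) a i → (∀ j' < j, ∀ i' ≤ n, cornerOrbit ((shiftData E w).bcBondConfig ω) a' j' ≠ cornerOrbit (E.bcBondConfig ω) a i') → ℓ ≠ 0 → ∑ t ∈ Finset.range i, turnOf (E.bcBondConfig ω) (cornerOrbit (E.bcBondConfig ω) a t) - ∑ t ∈ Finset.range j, turnOf ((shiftData E w).bcBondConfig ω) (cornerOrbit ((shiftData E w).bcBondConfig ω) a' t) = 2 * Real.pi * ℓ → ((∃ t < j, ρ / 2 / 2 ≤ dist (meshPoint E.δ (cornerOrbit ((shiftData E w).bcBondConfig ω) a' t).1) (meshPoint E.δ a.1)) ∨ (∃ t < i, ρ / 2 / 2 + E.δ ≤ dist (meshPoint E.δ (cornerOrbit (E.bcBondConfig ω) a t).1) (meshPoint E.δ a.1))) → ∃ z ∈ D.carrier, infDist z D.carrierᶜ < 3 * η ∧ (ω ∈ ufrsCert E w z (4 * η) (ρ / 2) ∨ (z ∈ ufrsMarkedNbhd E w (4 * η) ∧ ∃ R' : ℝ, (∃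 k : ℕ, R' = ρ / 2 / 2 / 2 ^ (k + 1)) ∧ 32 * (4 * η) ≤ R' ∧ ω ∈ ufrsStrands E w z 2 (4 * η) R' ∧ ω ∈ ufrsStrands E w z 2 (4 * R') (ρ / 2 / 2))) := by
  intro D η hη
  obtain ⟨δ₂, hδ₂, hcollar⟩ := collarAgreement D η hη
  refine ⟨min δ₂ η, lt_min hδ₂ hη, ?_⟩
  intro E hEΩ hE hEδ v w ρ hηρ hv hw ω a a' n T j i ℓ ha ha' hStr hball _ hrun _ hjT hin hEq hfirst _ _ hbig
  have hδ : 0 < E.δ := hE.delta_pos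
  have hδ₂' : E.δ < δ₂ := lt_of_lt_of_le hEδ (min_le_left _ _)
  have hδη : E.δ ≤ η := (lt_of_lt_of_le hEδ (min_le_right _ _)).le
  have hE₁ : (shiftData E w).IsZdAdmissible := isZdAdmissible_shiftData E w hE
  have ha'eq : a' = (a.1 + w, a.2) := eq_shift_of_isStartCorner hE ha ha'
  -- inner faces at deep vertices
  have hinner : ∀ x : Site 2, 3 * η ≤ infDist (meshPoint E.δ x) D.carrierᶜ → ∀ f : Site 2,
      IsCorner x f → E.IsInnerFace f ∧ (shiftData E w).IsInnerFace f := fun x hx =>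
    (hcollar E hEΩ hE hδ₂' w hw ω x hx x (by rw [dist_self]; positivity)).2
  -- the start vertex is a collar point of `D`
  have hcol : infDist (meshPoint E.δ a.1) D.carrierᶜ < 3 * η := by
    by_contra hdeep
    rw [not_lt] at hdeep
    exact ha.isOutEdge.2 (hinner a.1 hdeep _ (isCorner_faceAt _ _)).1
  have hzD : (meshPoint E.δ a.1) ∈ D.carrier := by
    rw [← hEΩ]
    exact (ufrs_discrepancyEdges E w ω).2.2 a ha.isOutEdge.1
  refine ⟨meshPoint E.δ a.1, hzD, hcol, ?_⟩
  -- escape regime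
  by_cases hesc : ρ / 2 < 256 * (4 * η)
  · exact Or.inl (mem_ufrsCert_of_lt_W3H hesc)
  rw [not_lt] at hesc
  -- the faces of the two start strands are inner, the strands are simple
  have hface₀ : ∀ t ≤ n, E.IsInnerFace (cFace (cornerOrbit (E.bcBondConfig ω) a t)) := by
    intro t ht
    rcases Nat.eq_zero_or_pos t with rfl | hpos
    · exact ha.isOutEdge.1
    · obtain ⟨t', rfl⟩ : ∃ t', t = t' + 1 := ⟨t - 1, by omega⟩
      exact (hStr t' (by omega)).2
  have hface₁ : ∀ t ≤ T, (shiftData E w).IsInnerFace (cFace (cornerOrbit ((shiftData E w).bcBondConfig ω) a' t)) := by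
    intro t ht
    rcases Nat.eq_zero_or_pos t with rfl | hpos
    · exact ha'.isOutEdge.1
    · obtain ⟨t', rfl⟩ : ∃ t', t = t' + 1 := ⟨t - 1, by omega⟩
      exact (hrun t' (by omega)).2
  have hsimple₀ : ∀ s t, s < t → t ≤ n → cornerOrbit (E.bcBondConfig ω) a s ≠ cornerOrbit (E.bcBondConfig ω) a t :=
    fun s t hst htn => cornerOrbit_ne hE ha hst (fun k hk => hface₀ k (by omega))
  have hsimple₁ : ∀ s t, s < t → t ≤ T → cornerOrbit ((shiftData E w).bcBondConfig ω) a' s ≠ cornerOrbit ((shiftData E w).bcBondConfig ω) a' t :=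
    fun s t hst htT => cornerOrbit_ne hE₁ ha' hst (fun k hk => hface₁ k (by omega))
  -- distances from the start vertex
  have hfar₀ : ρ - 3 * η - 2 * E.δ - 0 < dist (meshPoint E.δ (cornerOrbit (E.bcBondConfig ω) a n).1) (meshPoint E.δ a.1) :=
    far_of_near_cTgt_mem_ball_W3H hδ.le hv hcol (by rw [dist_self]) hball (by rw [dist_self]; exact hδ.le)
  have hnear₀ : dist (meshPoint E.δ (cornerOrbit (E.bcBondConfig ω) a 0).1) (meshPoint E.δ a.1) = 0 := by
    show dist (meshPoint E.δ a.1) (meshPoint E.δ a.1) = 0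
    rw [dist_self]
  have hnear₁ : dist (meshPoint E.δ (cornerOrbit ((shiftData E w).bcBondConfig ω) a' 0).1) (meshPoint E.δ a.1) ≤ η := by
    have h1 : (cornerOrbit ((shiftData E w).bcBondConfig ω) a' 0).1 = a.1 + w := by
      show a'.1 = a.1 + w
      rw [ha'eq]
    rw [h1, meshPoint_add_shift, dist_eq_norm, add_sub_cancel_right]
    exact hw.le
  have hmark₀ : ∀ ρ' : ℝ, E.δ ≤ ρ' → meshPoint E.δ a.1 ∈ ufrsMarkedNbhd E w ρ' := by
    intro ρ' hρ'
    rw [mem_ufrsMarkedNbhd_iff]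
    refine ⟨cSrc a, Or.inl (DiscreteDobrushin.cSrc_mem_zdABEdges ha.mem_zdArcA ha.mem_zdArcB (Or.inl ha.isOutEdge)), ?_⟩
    exact (dist_medialPoint_cSrc_le' hδ.le a).trans hρ'
  -- the pieces of the two start strands in the format of `ufrsStrands`
  have hσ₀ : ∀ (r R' : ℝ) (t₀ : ℕ), 0 ≤ r → t₀ ≤ n → R' ≤ dist (meshPoint E.δ (cornerOrbit (E.bcBondConfig ω) a t₀).1) (meshPoint E.δ a.1) →
      0 ≤ t₀ ∧ ((dist (meshPoint E.δ (cornerOrbit (E.bcBondConfig ω) a 0).1) (meshPoint E.δ a.1) ≤ r ∧ R' ≤ dist (meshPoint E.δ (cornerOrbit (E.bcBondConfig ω) a t₀).1) (meshPoint E.δ a.1)) ∨ (R' ≤ dist (meshPoint E.δ (cornerOrbit (E.bcBondConfig ω) a 0).1) (meshPoint E.δ a.1) ∧ dist (meshPoint E.δ (cornerOrbit (E.bcBondConfig ω) a t₀).1) (meshPoint E.δ a.1) ≤ r)) ∧ (∀ t, 0 ≤ t → t ≤ t₀ → E.IsInnerFace (cFace (cornerOrbit (E.bcBondConfig ω) a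 t))) ∧ (∀ s t, 0 ≤ s → s < t → t ≤ t₀ → cornerOrbit (E.bcBondConfig ω) a s ≠ cornerOrbit (E.bcBondConfig ω) a t) := by
    intro r R' t₀ hr ht₀ hR'
    exact ⟨Nat.zero_le _, Or.inl ⟨by rw [hnear₀]; exact hr, hR'⟩, fun t _ ht => hface₀ t (by omega), fun s t _ hst htn => hsimple₀ s t hst (by omega)⟩
  have hσ₀' : ∀ (r R' : ℝ) (t₀ : ℕ), t₀ + 1 ≤ i → R' ≤ dist (meshPoint E.δ (cornerOrbit (E.bcBondConfig ω) a (t₀ + 1)).1) (meshPoint E.δ a.1) →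
      dist (meshPoint E.δ (cornerOrbit (E.bcBondConfig ω) a i).1) (meshPoint E.δ a.1) ≤ r →
      t₀ + 1 ≤ i ∧ ((dist (meshPoint E.δ (cornerOrbit (E.bcBondConfig ω) a (t₀ + 1)).1) (meshPoint E.δ a.1) ≤ r ∧ R' ≤ dist (meshPoint E.δ (cornerOrbit (E.bcBondConfig ω) a i).1) (meshPoint E.δ a.1)) ∨ (R' ≤ dist (meshPoint E.δ (cornerOrbit (E.bcBondConfig ω) a (t₀ + 1)).1) (meshPoint E.δ a.1) ∧ dist (meshPoint E.δ (cornerOrbit (E.bcBondConfig ω) a i).1) (meshPoint E.δ a.1) ≤ r)) ∧ (∀ t, t₀ + 1 ≤ t → t ≤ i → E.IsInnerFace (cFace (cornerOrbit (E.bcBondConfig ω) a t))) ∧ (∀ s t, t₀ + 1 ≤ s → s < t → t ≤ i → cornerOrbit (E.bcBondConfig ω) a s ≠ cornerOrbit (E.bcBondConfig ω) a t) := by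
    intro r R' t₀ ht₀ hR' hr
    exact ⟨ht₀, Or.inr ⟨hR', hr⟩, fun t _ ht => hface₀ t (by omega), fun s t _ hst hti => hsimple₀ s t hst (by omega)⟩
  have hσ₁ : ∀ (r R' : ℝ) (t₁ : ℕ), η ≤ r → t₁ < j → R' ≤ dist (meshPoint E.δ (cornerOrbit ((shiftData E w).bcBondConfig ω) a' t₁).1) (meshPoint E.δ a.1) →
      0 ≤ t₁ ∧ ((dist (meshPoint E.δ (cornerOrbit ((shiftData E w).bcBondConfig ω) a' 0).1) (meshPoint E.δ a.1) ≤ r ∧ R' ≤ dist (meshPoint E.δ (cornerOrbit ((shiftData E w).bcBondConfig ω) a' t₁).1) (meshPoint E.δ a.1)) ∨ (R' ≤ dist (meshPoint E.δ (cornerOrbit ((shiftData E w).bcBondConfig ω) a' 0).1) (meshPoint E.δ a.1) ∧ dist (meshPoint E.δ (cornerOrbit ((shiftData E w).bcBondConfig ω) a' t₁).1) (meshPoint E.δ a.1) ≤ r)) ∧ (∀ t, 0 ≤ t → t ≤ t₁ → (shiftData E w).IsInnerFace (cFace (cornerOrbit ((shiftData E w).bcBondConfig ω) a' t))) ∧ (∀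 s t, 0 ≤ s → s < t → t ≤ t₁ → cornerOrbit ((shiftData E w).bcBondConfig ω) a' s ≠ cornerOrbit ((shiftData E w).bcBondConfig ω) a' t) := by
    intro r R' t₁ hr ht₁ hR'
    exact ⟨Nat.zero_le _, Or.inl ⟨hnear₁.trans hr, hR'⟩, fun t _ ht => hface₁ t (by omega), fun s t _ hst ht => hsimple₁ s t hst (by omega)⟩
  have hd₀₁ : ∀ t₁ : ℕ, t₁ < j → ∀ s t, 0 ≤ s → s ≤ n → 0 ≤ t → t ≤ t₁ → cornerOrbit (E.bcBondConfig ω) a s ≠ cornerOrbit ((shiftData E w).bcBondConfig ω) a' t :=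
    fun t₁ ht₁ s t _ hs _ ht h => hfirst t (by omega) s hs h.symm
  have hρ4 : ρ / 2 / 2 ≤ ρ - 3 * η - 2 * E.δ - 0 := by linarith
  have hρ0 : 0 < ρ := by linarith
  by_cases hA : ∃ t < j, ρ / 2 / 2 ≤ dist (meshPoint E.δ (cornerOrbit ((shiftData E w).bcBondConfig ω) a' t).1) (meshPoint E.δ a.1)
  · -- a long second strand: NEAR at the start vertex from `S₀` and the prefix of `P₁'`
    obtain ⟨t₁, ht₁j, ht₁⟩ := hA
    left
    apply mem_ufrsCert_of_near_W3H
    apply mem_ufrsCertNear_of_strands_W3H (hmark₀ _ (by linarith))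
    exact mem_ufrsStrands_two_W3H true false a a' 0 n 0 t₁ (hσ₀ _ _ n (by positivity) le_rfl (by linarith))
      (hσ₁ _ _ t₁ (by linarith) ht₁j ht₁) (hd₀₁ t₁ ht₁j)
  · -- `P₁'` stays within `ρ/4`; so the first start strand reaches `ρ/4 + E.δ` before the contact
    push Not at hA
    obtain ⟨t₀, ht₀i, ht₀⟩ : ∃ t < i, ρ / 2 / 2 + E.δ ≤ dist (meshPoint E.δ (cornerOrbit (E.bcBondConfig ω) a t).1) (meshPoint E.δ a.1) := by
      rcases hbig with ⟨t₁, ht₁j, ht₁⟩ | h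
      · exact absurd ht₁ (not_le.2 (hA t₁ ht₁j))
      · exact h
    have ht₀' : ρ / 2 / 2 ≤ dist (meshPoint E.δ (cornerOrbit (E.bcBondConfig ω) a (t₀ + 1)).1) (meshPoint E.δ a.1) := by
      have h1 := dist_meshPoint_cornerOrbit_succ_le (E.bcBondConfig ω) a E.δ t₀
      rw [abs_of_pos hδ] at h1
      have h2 := dist_triangle (meshPoint E.δ (cornerOrbit (E.bcBondConfig ω) a t₀).1) (meshPoint E.δ (cornerOrbit (E.bcBondConfig ω) a (t₀ + 1)).1) (meshPoint E.δ a.1)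
      rw [dist_comm] at h1
      linarith
    -- the distance of the contact corner from the start vertex
    set dc := dist (meshPoint E.δ (cornerOrbit (E.bcBondConfig ω) a i).1) (meshPoint E.δ a.1) with hdc
    by_cases hnear : dc ≤ 128 * (4 * η)
    · -- NEAR from the two pieces `O₀ a [0, t₀]`, `O₀ a [t₀ + 1, i]` of the first start strand
      left
      apply mem_ufrsCert_of_near_W3H
      apply mem_ufrsCertNear_of_strands_W3H (hmark₀ _ (by linarith))
      exact mem_ufrsStrands_two_W3H true true a a 0 t₀ (t₀ + 1) i (hσ₀ _ _ t₀ (by positivity) (by omega) (by linarith))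
        (hσ₀' _ _ t₀ (by omega) ht₀' hnear) (fun s t _ hs ht hti => hsimple₀ s t (by omega) (by omega))
    · -- the junction data: `P₁'` has extent `u ∈ [dc - E.δ, ρ/4)`, `dc > 512 η`
      right
      rw [not_le] at hnear
      -- `j ≥ 1`: otherwise the contact corner is `a'`, within `η` of the start vertex
      have hj1 : 1 ≤ j := by
        rcases Nat.eq_zero_or_pos j with rfl | hpos
        · exfalso
          have : dc ≤ η := by
            rw [hdc, ← hEq]
            exact hnear₁
          linarith
        · exact hpos
      -- the farthest corner of `P₁'`
      obtain ⟨t₁, ht₁m, ht₁max⟩ := Finset.exists_max_image (Finset.range j)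
        (fun t => dist (meshPoint E.δ (cornerOrbit ((shiftData E w).bcBondConfig ω) a' t).1) (meshPoint E.δ a.1))
        ⟨0, Finset.mem_range.2 hj1⟩
      rw [Finset.mem_range] at ht₁m
      set u := dist (meshPoint E.δ (cornerOrbit ((shiftData E w).bcBondConfig ω) a' t₁).1) (meshPoint E.δ a.1) with hu
      have huρ : u < ρ / 2 / 2 := hA t₁ ht₁m
      have hu_ge : dc - E.δ ≤ u := by
        have h1 := dist_meshPoint_cornerOrbit_succ_le ((shiftData E w).bcBondConfig ω) a' E.δ (j - 1)
        rw [abs_of_pos hδ, Nat.sub_add_cancel hj1, hEq] at h1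
        have h2 := dist_triangle (meshPoint E.δ (cornerOrbit (E.bcBondConfig ω) a i).1)
          (meshPoint E.δ (cornerOrbit ((shiftData E w).bcBondConfig ω) a' (j - 1)).1) (meshPoint E.δ a.1)
        have h3 : dist (meshPoint E.δ (cornerOrbit ((shiftData E w).bcBondConfig ω) a' (j - 1)).1) (meshPoint E.δ a.1) ≤ u :=
          ht₁max (j - 1) (Finset.mem_range.2 (by omega))
        linarith
      have hu0 : 0 < u := by linarith
      obtain ⟨k, hk₁, hk₂⟩ := exists_dyadic_scale_W3H (R := ρ / 2) (x := u) hu0 (by linarith)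
      -- `R' < ρ/4` forces `k ≥ 1`
      have hkpos : k ≠ 0 := by
        rintro rfl
        rw [pow_zero, div_one] at hk₂
        linarith
      obtain ⟨k', rfl⟩ : ∃ k', k = k' + 1 := ⟨k - 1, by omega⟩
      refine ⟨hmark₀ _ (by linarith), ρ / 2 / 2 / 2 ^ (k' + 1), ⟨k', rfl⟩, by linarith, ?_, ?_⟩
      · -- small annulus `A(z; 4η, R')`: `S₀` and `P₁'` up to its farthest corner
        exact mem_ufrsStrands_two_W3H true false a a' 0 n 0 t₁ (hσ₀ _ _ n (by positivity) le_rfl (by linarith))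
          (hσ₁ _ _ t₁ (by linarith) ht₁m hk₂) (hd₀₁ t₁ ht₁m)
      · -- large annulus `A(z; 4R', ρ/4)`: the two pieces of the first start strand
        exact mem_ufrsStrands_two_W3H true true a a 0 t₀ (t₀ + 1) i (hσ₀ _ _ t₀ (by positivity) (by omega) (by linarith))
          (hσ₀' _ _ t₀ (by omega) ht₀' (by linarith)) (fun s t _ hs ht hti => hsimple₀ s t (by omega) (by omega))

end

end Summit.CriticalPhenomena.CardyFormulaZ2.Cruxes.EdgePrecompact.QkzStripBoundaryArm
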